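import Summits.ResolutionOfSingularities.ResolutionOfSingularities.Theorems.SharpStrataSepExcModelsModelSpreadsFibres
import HarnessLib

/-!
# Separable regular birational local models spread along the stratum, II: the model at a point

Second of three files proving the stub `stub_modelSpreads` (BPR 2022, Lemma 4.2 / Prop. 2.1).
With `C = A[s] ⊆ K` an affine model and `R' = A_{P'} ⊆ K`, `B' = R'[s] = C_{P'}` (all PROVED):

* `exists_smooth_away_of_avatar`, `exists_model_at_prime` — **the model at a point of the good
  open**: if `Q'` is a prime of `C` over `P'` with `C_{Q'}` regular and `κ(Q')` formally smooth
  over `A/P'`, then `𝔮' = Q'B'` is a prime over `m_{R'}` with `B'_{𝔮'}` regular and `B'/𝔮'`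
  smooth over `κ(P') = R'/m_{R'}` on a non-empty basic open `D(g')`;
* `isSmoothAt_bot_of_avatar`, `isSmoothAt_bot_of_model` — **extraction**: conversely, from a
  prime `𝔮` of `B = R[s]` (`R = A_P`) over `m_R` and `g ∉ 𝔮` with `(B/𝔮)[1/g]` smooth over
  `κ(P)`, the affine model `D = C/(𝔮 ∩ C)` is smooth over `A/P` at its generic point.

Residue fields are compared through avatars (`exists_ringEquiv_residueField` of part I): the
fraction fields of `B'/𝔮'`, `C/Q'`, `(B/𝔮)[1/g]` are all residue fields of `C` at the same prime.

## Sources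

* A. Benito, O. Piltant, A. J. Reguera, *Small irreducible components of arc spaces in positive
  characteristic*, J. Pure Appl. Algebra 226 (2022) 107113, Lemma 4.2, Prop. 4.3.
  [BenitoPiltantReguera2022]
* The Stacks Project, Tags 00TB/00TA (smooth locus is open). [StacksProject]
-/

noncomputable section

-- single-problem summit: the doubled namespace component `ResolutionOfSingularities` is forced
set_option linter.dupNamespace false

open CategoryTheory AlgebraicGeometry TopologicalSpace Topology
open Literature.AlgebraicGeometry.Resolution

namespace Summit.ResolutionOfSingularities.ResolutionOfSingularities.Theorems.SepExcModels.ModelSpreads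

open IsLocalRing

/-! ## The model at a point of the good open -/

/-- **Generic smoothness of a domain from separability of its fraction field, via avatars.**
Let `T` be a domain of finite type over a Noetherian ring `L`, and suppose the fraction field of
`T` and a field `X` are both residue fields of the same prime of a ring `C` (presented by maps
`ψ : C → X`, `ψ₁ : C → Frac T` surjective on stalks with the same kernel), compatibly with a
common base `A ↠ A₁ → L`, `A₁ → X`, with `L` formally unramified over `A₁`. If `X` is formally
smooth over `A₁` then so is `Frac T`, hence `Frac T` is formally smooth over `L` and `T` is smooth
over `L` on a non-empty basic open (openness of the smooth locus, Stacks 00TA).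
[cite: StacksProject, Tag 00TB] -/
theorem exists_smooth_away_of_avatar {A A₁ C L T X : Type} [CommRing A] [CommRing A₁]
    [CommRing C] [CommRing L] [IsNoetherianRing L] [CommRing T] [IsDomain T] [Field X]
    [Algebra A A₁] [Algebra A C] [Algebra A₁ X] [Algebra L T] [Algebra.FiniteType L T]
    [Algebra A₁ L] [Algebra.FormallyUnramified A₁ L]
    (hA₁ : Function.Surjective (algebraMap A A₁)) (hXsm : Algebra.FormallySmooth A₁ X)
    (ψ : C →+* X) (hψ : ψ.SurjectiveOnStalks) (ψ₁ : C →+* FractionRing T)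
    (hψ₁ : ψ₁.SurjectiveOnStalks) (hker : RingHom.ker ψ = RingHom.ker ψ₁)
    (hcompat : ∀ a, ψ (algebraMap A C a) = algebraMap A₁ X (algebraMap A A₁ a))
    (hcompat₁ : ∀ a, ψ₁ (algebraMap A C a) =
      algebraMap L (FractionRing T) (algebraMap A₁ L (algebraMap A A₁ a))) :
    ∃ t : T, t ≠ 0 ∧ Algebra.Smooth L (Localization.Away t) := by
  haveI : Algebra.FinitePresentation L T := (Algebra.FinitePresentation.of_finiteType).mp ‹_›
  haveI : (RingHom.ker ψ).IsPrime := RingHom.ker_isPrime ψ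
  obtain ⟨e₀, he₀⟩ := exists_ringEquiv_residueField ψ hψ (RingHom.ker ψ) rfl
  obtain ⟨e₁, he₁⟩ := exists_ringEquiv_residueField ψ₁ hψ₁ (RingHom.ker ψ) hker
  have he : ∀ c, (e₀.symm.trans e₁) (ψ c) = ψ₁ c := fun c => by
    rw [RingEquiv.trans_apply, ← he₀, e₀.symm_apply_apply, he₁]
  -- `A₁`-structure on `Frac T`, formally smooth
  letI algA₁ : Algebra A₁ (FractionRing T) :=
    ((e₀.symm.trans e₁).toRingHom.comp (algebraMap A₁ X)).toAlgebra
  have halg : ∀ r : A₁, algebraMap A₁ (FractionRing T) r = (e₀.symm.trans e₁) (algebraMap A₁ X r) :=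
    fun r => rfl
  have hsmF : Algebra.FormallySmooth A₁ (FractionRing T) :=
    formallySmooth_of_ringEquiv (R := A₁) (e₀.symm.trans e₁) (fun r => (halg r).symm) hXsm
  haveI : IsScalarTower A₁ L (FractionRing T) := by
    refine IsScalarTower.of_algebraMap_eq fun r => ?_
    obtain ⟨a, rfl⟩ := hA₁ r
    rw [halg, ← hcompat, he, hcompat₁]
  have hsmL : Algebra.FormallySmooth L (FractionRing T) :=
    Algebra.FormallySmooth.of_restrictScalars A₁ _ _
  haveI : Algebra.IsSmoothAt L (⊥ : Ideal T) := isSmoothAt_bot_of_formallySmooth_fractionRing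
  obtain ⟨t, ht, htsm⟩ := Algebra.IsSmoothAt.exists_notMem_smooth L (⊥ : Ideal T)
  exact ⟨t, fun h => ht (by rw [h]; exact zero_mem _), htsm⟩

/-- **The local model at a point `w'` of the good open** (BPR Lemma 4.2, last step). Let
`R' = A_{P'} ⊆ K`, `B' = R'[s] = C_{P'}` (`C = A[s]`), and let `Q'` be a prime of `C` over `P'`
with `C_{Q'}` regular whose residue field `κ(Q')` — presented as the residue field of a prime `y`
of any ring `Z` under a map `φ : C → Z` surjective on stalks with `φ⁻¹(y) = Q'` — is formally
smooth over `A/P'` (presented as any quotient `A₁` of `A` through which `φ|_A` factors). Then `𝔮' = Q'B'` is a prime over `m_{R'}` with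
`B'_{𝔮'} = C_{Q'}` regular, and `B'/𝔮'`, a finitely generated `κ(P')`-domain with formally
smooth fraction field, is smooth over `κ(P') = R'/m_{R'}` on a non-empty basic open `D(g')`.
[cite: BenitoPiltantReguera2022, Lemma 4.2 and Prop. 4.3] -/
theorem exists_model_at_prime {A K R' : Type} [CommRing A] [IsNoetherianRing A] [Field K]
    [Algebra A K] [CommRing R'] [IsLocalRing R'] [Algebra A R'] [Algebra R' K]
    [IsScalarTower A R' K] (P' : Ideal A) [P'.IsPrime] [IsLocalization.AtPrime R' P']
    (s : Set K) (hs : s.Finite) [Algebra (Algebra.adjoin A s) (Algebra.adjoin R' s)]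
    (halg : ∀ c : Algebra.adjoin A s,
      (algebraMap (Algebra.adjoin A s) (Algebra.adjoin R' s) c : K) = c)
    [IsScalarTower A (Algebra.adjoin A s) (Algebra.adjoin R' s)]
    (Q' : Ideal (Algebra.adjoin A s)) [Q'.IsPrime]
    (hQ'A : Q'.comap (algebraMap A (Algebra.adjoin A s)) = P')
    (hreg : IsRegularLocalRing (Localization.AtPrime Q'))
    (A₁ Z : Type) [CommRing A₁] [CommRing Z] [Algebra A A₁] [Algebra A₁ Z]
    (hA₁ : Function.Surjective (algebraMap A A₁)) (y : Ideal Z) [y.IsPrime]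
    (hysm : Algebra.FormallySmooth A₁ y.ResidueField)
    (φ : Algebra.adjoin A s →+* Z) (hφ : φ.SurjectiveOnStalks) (hker : Q' = y.comap φ)
    (hcompat : ∀ a : A, φ (algebraMap A _ a) = algebraMap A₁ Z (algebraMap A A₁ a)) :
    ∃ (𝔮' : Ideal (Algebra.adjoin R' s)) (_ : 𝔮'.IsPrime)
      (hle' : IsLocalRing.maximalIdeal R' ≤ 𝔮'.comap (algebraMap R' (Algebra.adjoin R' s))),
      IsRegularLocalRing (Localization.AtPrime 𝔮') ∧
        ∃ g' : Algebra.adjoin R' s, g' ∉ 𝔮' ∧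
          @Algebra.Smooth (R' ⧸ IsLocalRing.maximalIdeal R') _ (Localization.Away (Ideal.Quotient.mk 𝔮' g')) _
            ((algebraMap _ (Localization.Away (Ideal.Quotient.mk 𝔮' g'))).comp
              (Ideal.quotientMap 𝔮' (algebraMap R' (Algebra.adjoin R' s)) hle')).toAlgebra := by
  classical
  haveI hM : IsLocalization (Algebra.algebraMapSubmonoid (Algebra.adjoin A s) P'.primeCompl)
      (Algebra.adjoin R' s) := isLocalization_adjoin P'.primeCompl s halg
  have hdisj : Disjoint
      (↑(Algebra.algebraMapSubmonoid (Algebra.adjoin A s) P'.primeCompl) : Set (Algebra.adjoin A s))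
      ↑Q' := by
    rw [Set.disjoint_left]
    rintro _ ⟨a, ha, rfl⟩ haQ
    refine ha ?_
    rw [← hQ'A]
    exact haQ
  haveI h𝔮' : (Q'.map (algebraMap (Algebra.adjoin A s) (Algebra.adjoin R' s))).IsPrime :=
    IsLocalization.isPrime_of_isPrime_disjoint _ (Algebra.adjoin R' s) Q' ‹_› hdisj
  have h𝔮'Q : (Q'.map (algebraMap (Algebra.adjoin A s) (Algebra.adjoin R' s))).comap
      (algebraMap (Algebra.adjoin A s) (Algebra.adjoin R' s)) = Q' :=
    IsLocalization.under_map_of_isPrime_disjoint _ (Algebra.adjoin R' s) ‹_› hdisj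
  have hle' : maximalIdeal R' ≤ (Q'.map (algebraMap (Algebra.adjoin A s)
      (Algebra.adjoin R' s))).comap (algebraMap R' (Algebra.adjoin R' s)) := by
    rw [← IsLocalization.AtPrime.map_eq_maximalIdeal P' R', Ideal.map_le_iff_le_comap,
      Ideal.comap_comap, ← IsScalarTower.algebraMap_eq,
      IsScalarTower.algebraMap_eq A (Algebra.adjoin A s) (Algebra.adjoin R' s), ← Ideal.comap_comap,
      h𝔮'Q, hQ'A]
  refine ⟨_, h𝔮', hle', ?_, ?_⟩
  · rwa [isRegularLocalRing_iff_of_isLocalization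
      (Algebra.algebraMapSubmonoid (Algebra.adjoin A s) P'.primeCompl) _ Q' h𝔮'Q]
  -- smoothness of `B'/𝔮'` over `κ(P')` on a basic open
  letI algLT : Algebra (R' ⧸ maximalIdeal R')
      (Algebra.adjoin R' s ⧸ Q'.map (algebraMap (Algebra.adjoin A s) (Algebra.adjoin R' s))) :=
    Ideal.Quotient.algebraQuotientOfLEComap hle'
  have halgLT : ∀ r : R', algebraMap (R' ⧸ maximalIdeal R')
      (Algebra.adjoin R' s ⧸ Q'.map (algebraMap (Algebra.adjoin A s) (Algebra.adjoin R' s)))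
      (Ideal.Quotient.mk (maximalIdeal R') r) =
      Ideal.Quotient.mk (Q'.map (algebraMap (Algebra.adjoin A s) (Algebra.adjoin R' s)))
        (algebraMap R' (Algebra.adjoin R' s) r) :=
    fun r => rfl
  haveI : IsScalarTower R' (R' ⧸ maximalIdeal R')
      (Algebra.adjoin R' s ⧸ Q'.map (algebraMap (Algebra.adjoin A s) (Algebra.adjoin R' s))) :=
    IsScalarTower.of_algebraMap_eq fun r => (halgLT r).symm
  haveI : IsNoetherianRing R' := IsLocalization.isNoetherianRing P'.primeCompl R' ‹_›
  haveI : Algebra.FiniteType R' (Algebra.adjoin R' s) := Algebra.FiniteType.adjoin_of_finite hs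
  haveI : Algebra.FiniteType (R' ⧸ maximalIdeal R')
      (Algebra.adjoin R' s ⧸ Q'.map (algebraMap (Algebra.adjoin A s) (Algebra.adjoin R' s))) :=
    Algebra.FiniteType.of_restrictScalars_finiteType R' _ _
  -- `A₁ → κ(P') = R'/m`
  have hkerA : RingHom.ker (algebraMap A A₁) ≤
      RingHom.ker (algebraMap A (R' ⧸ maximalIdeal R')) := by
    intro a ha
    rw [RingHom.mem_ker] at ha ⊢
    have hmem : algebraMap A (Algebra.adjoin A s) a ∈ Q' := by
      rw [hker, Ideal.mem_comap, hcompat, ha, map_zero]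
      exact zero_mem _
    rw [← Ideal.mem_comap, hQ'A] at hmem
    rw [IsScalarTower.algebraMap_apply A R' (R' ⧸ maximalIdeal R'), Ideal.Quotient.algebraMap_eq,
      Ideal.Quotient.eq_zero_iff_mem]
    exact (IsLocalization.AtPrime.to_map_mem_maximal_iff R' P' a).mpr hmem
  letI algA₁L : Algebra A₁ (R' ⧸ maximalIdeal R') :=
    ((algebraMap A A₁).liftOfSurjective hA₁ ⟨algebraMap A _, hkerA⟩).toAlgebra
  have halgA₁L : ∀ a : A, algebraMap A₁ (R' ⧸ maximalIdeal R') (algebraMap A A₁ a) =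
      algebraMap A _ a :=
    fun a => (algebraMap A A₁).liftOfSurjective_comp_apply hA₁ ⟨_, hkerA⟩ a
  haveI : IsScalarTower A A₁ (R' ⧸ maximalIdeal R') :=
    IsScalarTower.of_algebraMap_eq fun a => (halgA₁L a).symm
  haveI : Algebra.FormallyUnramified A R' :=
    Algebra.FormallyUnramified.of_isLocalization (M := P'.primeCompl)
  haveI : Algebra.FormallyUnramified A₁ (R' ⧸ maximalIdeal R') :=
    Algebra.FormallyUnramified.of_restrictScalars A _ _
  -- the avatar `Frac (B'/𝔮')` of `κ(Q')`
  let ψ₁ : Algebra.adjoin A s →+* FractionRing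
      (Algebra.adjoin R' s ⧸ Q'.map (algebraMap (Algebra.adjoin A s) (Algebra.adjoin R' s))) :=
    (algebraMap _ (FractionRing _)).comp ((Ideal.Quotient.mk
      (Q'.map (algebraMap (Algebra.adjoin A s) (Algebra.adjoin R' s)))).comp
      (algebraMap (Algebra.adjoin A s) (Algebra.adjoin R' s)))
  have hψ₁app : ∀ c, ψ₁ c = algebraMap _ (FractionRing _) (Ideal.Quotient.mk
      (Q'.map (algebraMap (Algebra.adjoin A s) (Algebra.adjoin R' s)))
      (algebraMap (Algebra.adjoin A s) (Algebra.adjoin R' s) c)) := fun c => rfl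
  have hψ₁ : ψ₁.SurjectiveOnStalks :=
    (RingHom.surjectiveOnStalks_of_isLocalization (nonZeroDivisors _) (FractionRing _)).comp
      ((RingHom.surjectiveOnStalks_of_surjective Ideal.Quotient.mk_surjective).comp
        (RingHom.surjectiveOnStalks_of_isLocalization
          (Algebra.algebraMapSubmonoid (Algebra.adjoin A s) P'.primeCompl) (Algebra.adjoin R' s)))
  -- the avatar `κ(y)` of `κ(Q')`
  let ψ : Algebra.adjoin A s →+* y.ResidueField := (algebraMap Z y.ResidueField).comp φ
  have hψapp : ∀ c, ψ c = algebraMap Z y.ResidueField (φ c) := fun c => rfl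
  have hψ : ψ.SurjectiveOnStalks := (Ideal.surjectiveOnStalks_residueField y).comp hφ
  have hkerψ : Q' = RingHom.ker ψ := by
    rw [hker]
    ext c
    rw [RingHom.mem_ker, hψapp, Ideal.algebraMap_residueField_eq_zero, Ideal.mem_comap]
  have hcompatψ : ∀ a : A, ψ (algebraMap A _ a) = algebraMap A₁ y.ResidueField (algebraMap A A₁ a) :=
    fun a => by rw [hψapp, hcompat, ← IsScalarTower.algebraMap_apply]
  have hker₁ : RingHom.ker ψ = RingHom.ker ψ₁ := by
    rw [← hkerψ]
    ext c
    rw [RingHom.mem_ker, hψ₁app, map_eq_zero_iff _ (IsFractionRing.injective _ _),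
      Ideal.Quotient.eq_zero_iff_mem, ← Ideal.mem_comap, h𝔮'Q]
  have hcompat₁ : ∀ a, ψ₁ (algebraMap A _ a) = algebraMap (R' ⧸ maximalIdeal R') (FractionRing _)
      (algebraMap A₁ (R' ⧸ maximalIdeal R') (algebraMap A A₁ a)) := by
    intro a
    rw [hψ₁app, halgA₁L, IsScalarTower.algebraMap_apply (R' ⧸ maximalIdeal R')
      (Algebra.adjoin R' s ⧸ Q'.map (algebraMap (Algebra.adjoin A s) (Algebra.adjoin R' s)))
      (FractionRing _), IsScalarTower.algebraMap_apply A R' (R' ⧸ maximalIdeal R'),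
      Ideal.Quotient.algebraMap_eq, halgLT, ← IsScalarTower.algebraMap_apply,
      ← IsScalarTower.algebraMap_apply]
  obtain ⟨t, ht, htsm⟩ := exists_smooth_away_of_avatar hA₁ hysm ψ hψ ψ₁ hψ₁ hker₁ hcompatψ hcompat₁
  obtain ⟨g', rfl⟩ := Ideal.Quotient.mk_surjective t
  refine ⟨g', fun hg => ht ?_, ?_⟩
  · rw [Ideal.Quotient.eq_zero_iff_mem]
    exact hg
  · convert htsm using 1
    exact Algebra.algebra_ext _ _ fun r => (IsScalarTower.algebraMap_apply (R' ⧸ maximalIdeal R')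
      (Algebra.adjoin R' s ⧸ Q'.map (algebraMap (Algebra.adjoin A s) (Algebra.adjoin R' s))) _ r).symm

/-! ## Extraction: the generic fibre of `C/Q → A/P` is separable -/

/-- **Generic-point smoothness from a smooth local chart, via avatars.** Let `A₀ → L → E` with
`L` formally smooth over `A₀` and `E = T[1/t]` formally smooth over `L` (`T` a domain, `t ≠ 0`),
and let `D` be an `A₀`-domain such that `Frac T` and `Frac D` are residue fields of the same
prime of a ring `C` (presented by `φ₁ : C → T`, `φ₂ : C → D` surjective on stalks with equal
kernels), compatibly with `A₀`. Then `Frac D ≅ Frac T ⊇ E` is formally smooth over `A₀`, i.e.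
`D` is smooth over `A₀` at its generic point. [folklore] -/
theorem isSmoothAt_bot_of_avatar {A₀ L E T D C : Type} [CommRing A₀] [CommRing L] [CommRing E]
    [IsDomain E] [CommRing T] [IsDomain T] [CommRing D] [IsDomain D] [CommRing C]
    [Algebra A₀ L] [Algebra L E] [Algebra A₀ E] [IsScalarTower A₀ L E]
    (hL : Algebra.FormallySmooth A₀ L) (hE : Algebra.FormallySmooth L E)
    [Algebra T E] (t : T) (ht : t ≠ 0) [IsLocalization.Away t E] [Algebra A₀ D]
    (φ₁ : C →+* T) (hφ₁ : φ₁.SurjectiveOnStalks) (φ₂ : C →+* D) (hφ₂ : φ₂.SurjectiveOnStalks)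
    (hker : RingHom.ker φ₁ = RingHom.ker φ₂)
    (hcompat : ∀ r : A₀, ∃ c : C, algebraMap T E (φ₁ c) = algebraMap A₀ E r ∧
      φ₂ c = algebraMap A₀ D r) :
    Algebra.IsSmoothAt A₀ (⊥ : Ideal D) := by
  -- `Frac T` as an algebra over `E = T[1/t]`: a localisation, hence formally smooth
  have hunit : IsUnit (algebraMap T (FractionRing T) t) :=
    IsLocalization.map_units (FractionRing T) ⟨t, mem_nonZeroDivisors_of_ne_zero ht⟩
  letI algEF : Algebra E (FractionRing T) := (IsLocalization.Away.lift (S := E) t hunit).toAlgebra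
  have hEF : ∀ x : T, algebraMap E (FractionRing T) (algebraMap T E x) =
      algebraMap T (FractionRing T) x :=
    fun x => IsLocalization.Away.lift_eq (S := E) t hunit x
  haveI := IsScalarTower.of_algebraMap_eq (R := T) (S := E) (A := FractionRing T)
    fun x => (hEF x).symm
  haveI : IsFractionRing E (FractionRing T) :=
    IsFractionRing.isFractionRing_of_isDomain_of_isLocalization (.powers t) _ _
  haveI : Algebra.FormallySmooth E (FractionRing T) :=
    Algebra.FormallySmooth.of_isLocalization (nonZeroDivisors E)
  letI algAF : Algebra A₀ (FractionRing T) :=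
    ((algebraMap E (FractionRing T)).comp (algebraMap A₀ E)).toAlgebra
  have hAF : ∀ r : A₀, algebraMap A₀ (FractionRing T) r =
      algebraMap E (FractionRing T) (algebraMap A₀ E r) := fun r => rfl
  haveI := IsScalarTower.of_algebraMap_eq (R := A₀) (S := E) (A := FractionRing T) hAF
  haveI : Algebra.FormallySmooth A₀ E := Algebra.FormallySmooth.comp A₀ L E
  have hsmFT : Algebra.FormallySmooth A₀ (FractionRing T) :=
    Algebra.FormallySmooth.comp A₀ E (FractionRing T)
  -- the two avatars
  let ψ₁ : C →+* FractionRing T := (algebraMap T (FractionRing T)).comp φ₁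
  have hψ₁app : ∀ c, ψ₁ c = algebraMap T (FractionRing T) (φ₁ c) := fun c => rfl
  have hψ₁ : ψ₁.SurjectiveOnStalks :=
    (RingHom.surjectiveOnStalks_of_isLocalization (nonZeroDivisors T) (FractionRing T)).comp hφ₁
  let ψ₂ : C →+* FractionRing D := (algebraMap D (FractionRing D)).comp φ₂
  have hψ₂app : ∀ c, ψ₂ c = algebraMap D (FractionRing D) (φ₂ c) := fun c => rfl
  have hψ₂ : ψ₂.SurjectiveOnStalks :=
    (RingHom.surjectiveOnStalks_of_isLocalization (nonZeroDivisors D) (FractionRing D)).comp hφ₂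
  haveI : (RingHom.ker ψ₁).IsPrime := RingHom.ker_isPrime ψ₁
  have hker₁ : RingHom.ker ψ₁ = RingHom.ker φ₁ := by
    ext c
    rw [RingHom.mem_ker, RingHom.mem_ker, hψ₁app, map_eq_zero_iff _ (IsFractionRing.injective _ _)]
  have hker₂ : RingHom.ker ψ₁ = RingHom.ker ψ₂ := by
    rw [hker₁, hker]
    ext c
    rw [RingHom.mem_ker, RingHom.mem_ker, hψ₂app, map_eq_zero_iff _ (IsFractionRing.injective _ _)]
  obtain ⟨e₁, he₁⟩ := exists_ringEquiv_residueField ψ₁ hψ₁ _ rfl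
  obtain ⟨e₂, he₂⟩ := exists_ringEquiv_residueField ψ₂ hψ₂ _ hker₂
  have he : ∀ c, (e₁.symm.trans e₂) (ψ₁ c) = ψ₂ c := fun c => by
    rw [RingEquiv.trans_apply, ← he₁, e₁.symm_apply_apply, he₂]
  -- transport
  haveI : Algebra.FormallySmooth A₀ (FractionRing D) := by
    refine formallySmooth_of_ringEquiv (R := A₀) (e₁.symm.trans e₂) (fun r => ?_) hsmFT
    obtain ⟨c, hc₁, hc₂⟩ := hcompat r
    rw [hAF, ← hc₁, hEF, ← hψ₁app, he, hψ₂app, hc₂, ← IsScalarTower.algebraMap_apply]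
  exact isSmoothAt_bot_of_formallySmooth_fractionRing



/-- **From the local hypothesis to generic smoothness of the affine model.** With `R = A_P ⊆ K`,
`B = R[s] = C_P` (`C = A[s]`), a prime `𝔮` of `B` over `m_R` and `g ∉ 𝔮` with `(B/𝔮)[1/g]`
smooth over `κ(P) = R/m_R`: the contracted prime `Q = 𝔮 ∩ C` has `Frac(C/Q) = Frac((B/𝔮)[1/g])`
formally smooth over `κ(P)`, hence over `A/P`, i.e. `D = C/Q` is smooth over `A/P` at its
generic point. [cite: BenitoPiltantReguera2022, Lemma 4.2] -/
theorem isSmoothAt_bot_of_model {A K R : Type} [CommRing A] [Field K] [Algebra A K]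
    [CommRing R] [IsLocalRing R] [Algebra A R] [Algebra R K] [IsScalarTower A R K]
    (P : Ideal A) [P.IsPrime] [IsLocalization.AtPrime R P] (s : Set K)
    [Algebra (Algebra.adjoin A s) (Algebra.adjoin R s)]
    (halg : ∀ c : Algebra.adjoin A s,
      (algebraMap (Algebra.adjoin A s) (Algebra.adjoin R s) c : K) = c)
    [IsScalarTower A (Algebra.adjoin A s) (Algebra.adjoin R s)]
    (𝔮 : Ideal (Algebra.adjoin R s)) [𝔮.IsPrime]
    (hle : maximalIdeal R ≤ 𝔮.comap (algebraMap R (Algebra.adjoin R s)))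
    (g : Algebra.adjoin R s) (hg : g ∉ 𝔮)
    (hsm : @Algebra.Smooth (R ⧸ maximalIdeal R) _ (Localization.Away (Ideal.Quotient.mk 𝔮 g)) _
      ((algebraMap _ (Localization.Away (Ideal.Quotient.mk 𝔮 g))).comp
        (Ideal.quotientMap 𝔮 (algebraMap R (Algebra.adjoin R s)) hle)).toAlgebra)
    [Algebra (A ⧸ P)
      (Algebra.adjoin A s ⧸ 𝔮.comap (algebraMap (Algebra.adjoin A s) (Algebra.adjoin R s)))]
    [IsScalarTower A (A ⧸ P)
      (Algebra.adjoin A s ⧸ 𝔮.comap (algebraMap (Algebra.adjoin A s) (Algebra.adjoin R s)))] :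
    Algebra.IsSmoothAt (A ⧸ P) (⊥ : Ideal
      (Algebra.adjoin A s ⧸ 𝔮.comap (algebraMap (Algebra.adjoin A s) (Algebra.adjoin R s)))) := by
  classical
  haveI hM : IsLocalization (Algebra.algebraMapSubmonoid (Algebra.adjoin A s) P.primeCompl)
      (Algebra.adjoin R s) := isLocalization_adjoin P.primeCompl s halg
  have ht0 : Ideal.Quotient.mk 𝔮 g ≠ 0 := fun h => hg (Ideal.Quotient.eq_zero_iff_mem.mp h)
  have hpow : Submonoid.powers (Ideal.Quotient.mk 𝔮 g) ≤ nonZeroDivisors (Algebra.adjoin R s ⧸ 𝔮) :=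
    powers_le_nonZeroDivisors_of_noZeroDivisors ht0
  haveI : IsDomain (Localization.Away (Ideal.Quotient.mk 𝔮 g)) :=
    IsLocalization.isDomain_localization hpow
  -- the given `κ(P)`-structure on `E = (B/𝔮)[1/g]`
  letI instLE : Algebra (R ⧸ maximalIdeal R) (Localization.Away (Ideal.Quotient.mk 𝔮 g)) :=
    ((algebraMap _ (Localization.Away (Ideal.Quotient.mk 𝔮 g))).comp
      (Ideal.quotientMap 𝔮 (algebraMap R (Algebra.adjoin R s)) hle)).toAlgebra
  haveI : Algebra.Smooth (R ⧸ maximalIdeal R) (Localization.Away (Ideal.Quotient.mk 𝔮 g)) := hsm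
  have hLE : ∀ r : R, algebraMap (R ⧸ maximalIdeal R) (Localization.Away (Ideal.Quotient.mk 𝔮 g))
      (Ideal.Quotient.mk _ r) = algebraMap _ (Localization.Away (Ideal.Quotient.mk 𝔮 g))
        (Ideal.Quotient.mk 𝔮 (algebraMap R (Algebra.adjoin R s) r)) := fun r => rfl
  -- `A/P → κ(P) → E → Frac E`
  have hPm : P ≤ (maximalIdeal R).comap (algebraMap A R) :=
    (IsLocalization.AtPrime.under_maximalIdeal R P).ge
  letI instAL : Algebra (A ⧸ P) (R ⧸ maximalIdeal R) := Ideal.Quotient.algebraQuotientOfLEComap hPm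
  have hAL : ∀ a : A, algebraMap (A ⧸ P) (R ⧸ maximalIdeal R) (Ideal.Quotient.mk P a) =
      Ideal.Quotient.mk _ (algebraMap A R a) := fun a => rfl
  haveI := IsScalarTower.of_algebraMap_eq (R := A) (S := A ⧸ P) (A := R ⧸ maximalIdeal R)
    fun a => (hAL a).symm
  have hsmL : Algebra.FormallySmooth (A ⧸ P) (R ⧸ maximalIdeal R) :=
    formallySmooth_residue_of_isLocalization_atPrime P
  letI instAE : Algebra (A ⧸ P) (Localization.Away (Ideal.Quotient.mk 𝔮 g)) :=
    ((algebraMap (R ⧸ maximalIdeal R) (Localization.Away (Ideal.Quotient.mk 𝔮 g))).comp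
      (algebraMap (A ⧸ P) (R ⧸ maximalIdeal R))).toAlgebra
  have hAE : ∀ r : A ⧸ P, algebraMap (A ⧸ P) (Localization.Away (Ideal.Quotient.mk 𝔮 g)) r =
      algebraMap (R ⧸ maximalIdeal R) _ (algebraMap (A ⧸ P) (R ⧸ maximalIdeal R) r) := fun r => rfl
  haveI := IsScalarTower.of_algebraMap_eq (R := A ⧸ P) (S := R ⧸ maximalIdeal R)
    (A := Localization.Away (Ideal.Quotient.mk 𝔮 g)) hAE
  have hsmE : Algebra.FormallySmooth (R ⧸ maximalIdeal R) (Localization.Away (Ideal.Quotient.mk 𝔮 g)) :=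
    Algebra.Smooth.formallySmooth
  -- the two presentations of `κ(Q)`
  have hmk : (Ideal.Quotient.mk 𝔮).SurjectiveOnStalks :=
    RingHom.surjectiveOnStalks_of_surjective Ideal.Quotient.mk_surjective
  have hCB : (algebraMap (Algebra.adjoin A s) (Algebra.adjoin R s)).SurjectiveOnStalks :=
    RingHom.surjectiveOnStalks_of_isLocalization
      (Algebra.algebraMapSubmonoid (Algebra.adjoin A s) P.primeCompl) (Algebra.adjoin R s)
  have hφ₂ : (Ideal.Quotient.mk (𝔮.comap (algebraMap (Algebra.adjoin A s)
      (Algebra.adjoin R s)))).SurjectiveOnStalks :=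
    RingHom.surjectiveOnStalks_of_surjective Ideal.Quotient.mk_surjective
  have hker : RingHom.ker ((Ideal.Quotient.mk 𝔮).comp (algebraMap (Algebra.adjoin A s)
      (Algebra.adjoin R s))) = RingHom.ker (Ideal.Quotient.mk (𝔮.comap (algebraMap
        (Algebra.adjoin A s) (Algebra.adjoin R s)))) := by
    rw [Ideal.mk_ker]
    ext c
    rw [RingHom.mem_ker, RingHom.comp_apply, Ideal.Quotient.eq_zero_iff_mem, Ideal.mem_comap]
  refine isSmoothAt_bot_of_avatar (L := R ⧸ maximalIdeal R) hsmL hsmE (Ideal.Quotient.mk 𝔮 g) ht0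
    ((Ideal.Quotient.mk 𝔮).comp (algebraMap (Algebra.adjoin A s) (Algebra.adjoin R s)))
    (hmk.comp hCB) (Ideal.Quotient.mk _) hφ₂ hker fun r => ?_
  obtain ⟨a, rfl⟩ := Ideal.Quotient.mk_surjective r
  refine ⟨algebraMap A (Algebra.adjoin A s) a, ?_, ?_⟩
  · rw [hAE, hAL, hLE, RingHom.comp_apply, ← IsScalarTower.algebraMap_apply A (Algebra.adjoin A s),
      IsScalarTower.algebraMap_apply A R (Algebra.adjoin R s)]
  · rw [Ideal.Quotient.mk_algebraMap, IsScalarTower.algebraMap_apply A (A ⧸ P)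
      (Algebra.adjoin A s ⧸ 𝔮.comap (algebraMap (Algebra.adjoin A s) (Algebra.adjoin R s))),
      Ideal.Quotient.algebraMap_eq]

end Summit.ResolutionOfSingularities.ResolutionOfSingularities.Theorems.SepExcModels.ModelSpreads

end
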